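/-
Copyright (c) 2026 the pub-hodgecm-mathlib formalisation cell (harness21).  Prover seat hodgecm-mathlib-K2Liu-p12 (g0): Track B «K2-LIT»,
#184♮ = hLiu418 = stmt-HodgeConjecture-24832; Road Φ of socket #41, organ Φ5 «bad finite places» (LEAD F0P6-plan (g12) CAP-1 deal, REQUESTS l.72710), file F4a.
-/
import Summits.HodgeConjecture.HodgeConjecture.Theorems.K2LiuShellVanishingByAveraging   -- ★ F1: `setIntegral_eq_zero_of_averaging`, `setIntegral_comp_eq_of_preimage_eq`, `setIntegral_eq_zero_of_translate`
import Summits.HodgeConjecture.HodgeConjecture.Theorems.K2LiuSiegelLeviWeylAlgebra        -- ★ `blkB_matA_conj_nElem`, `conj_nElem_mem_unipDeltaLocal`, `isSiegelDelta_weylDelta_conj`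
import Summits.HodgeConjecture.HodgeConjecture.Theorems.K2LiuUnipDeltaLocalCoordinates     -- ★ `eq_nElem_of_mem_unipDeltaLocal`, `nElem_add`
import Literature.NumberTheory.GelbartRogawski1991.LocalDoubledTwistedSectionUnipotentWord   -- ★ `nElem_congr`
import Literature.NumberTheory.Automorphic.AdicCompletionLocalField                       -- ★ `F_v` is a non-archimedean local field
import HarnessLib

/-!
# Crux `HLiu418`, Road Φ of socket #41, organ Φ5 — FILE F4a: THE FAR SHELLS OF THE LOCAL WHITTAKER INTEGRAL VANISH (group level, Levi averaging)

Cell `hodgecm-mathlib`, crux item hLiu418 = `stmt-HodgeConjecture-24832`, route of record `HCCMUnconditional`; squad K2 ∕ K2Liu, road `K2_Liu`,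
socket #41 `sig_K2LiuSiegelEisensteinContinuation`, Road Φ (ruling «M-155l»), organ Φ5 «at a bad finite place `v`, for a `K_v`-finite Siegel section
`f_v` and `det β ≠ 0`, `s ↦ W_{β,v}(f_v,s)` is ENTIRE, bounded on compacta polynomially in `β`, and vanishes for `β` off an `f_v`-lattice»
(census `K2/K2Liu-p12/g0/CENSUS-PHI5-BadPlaceWhittaker.K2Liu-p12-g0.md` §3; files F1 ★ `K2LiuShellVanishingByAveraging`, F2 `K2LiuShellStabilization`).
THEOREMS ONLY (no `def`, no `instance`, no `notation`, no named-fact hypothesis, no `sorry`); lane `--supports stmt-HodgeConjecture-24832`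
(count-neutral helper; closes no socket by itself).

CARRIERS (★ D10 ∕ ★ GR91 local frame, general quadratic `E ∕ F`, finite place `v` of `F`): `H(F_v) = UnitaryGroup.localPi E c (n + n) J^𝔻 v`, the Weyl
element `w_Δ` (★ `weylDelta`, `w_Δ² = 1`), the elements `n(t)` (★ `nElem t ht`) for `t` in the additive group `Skew = {t ∈ M_n(E ⊗ F_v) : σ(t)ᵀT + T t = 0}`
(the coordinate group of `N_Δ(F_v)`, ★ `K2LiuUnipDeltaLocalCoordinates`), realised as ANY `S : AddSubgroup` with `S = Skew` as a set (the convention of ★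
`K2LiuSkewConjugationHaarChar` ∕ ★ `K2LiuUnipDeltaConjugationModulus`), an additive Haar measure `μ` on `S`, and a Siegel section `f ∈ I_v(s, χ_v)`
(★ D1 `IsLocalSiegelSection`) right-invariant under a subgroup `U` (its smoothness group).  The PULLED-BACK SECTION is `φ(t) := f(w_Δ n(t))`
(the value at `h`; for general `h` apply the file to the right translate `f(· h)`, again a Siegel section), and the local Whittaker integrand is
`φ(t)·χ(t)` for a unitary weight `χ` (`χ = ψ̄_{β,v} ∘ n`).

THE MATHEMATICS (Karel's lemma by LEVI AVERAGING; [Casselman1980, §3], [KudlaRallis1994, §2], [Shimura1997, §18]).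
* §1 `apply_weylDelta_nElem_conj` — **Levi invariance of the pulled-back section**: for a Levi element `q ∈ U` (adapted blocks `diag(A, D)`) with
  `χ_v(det_Δ(w_Δ q w_Δ)) = 1` and `|det_Δ(w_Δ q w_Δ)|_v = 1` (e.g. `q ∈ K_v ∩ M_Δ` of level `≥ cond χ_v`):  `φ(A t D⁻¹) = φ(t)`, because
  `n(A t D⁻¹) = q n(t) q⁻¹` (★ `blkB_matA_conj_nElem` + ★ `eq_nElem_of_mem_unipDeltaLocal` + ★ `nElem_congr`), `w_Δ q n(t) q⁻¹ = (w_Δ q w_Δ)(w_Δ n(t)) q⁻¹`, the Siegel law of `f`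
  at `w_Δ q w_Δ ∈ P_Δ(F_v)` (★ `isSiegelDelta_weylDelta_conj`) and right-`U`-invariance.
* §2 **`setIntegral_shell_eq_zero_of_levi`** — THE FAR SHELLS VANISH: on a measurable set `Sh ⊆ S` of finite measure (a shell `ϖ^{−k}Λ ∖ ϖ^{−k+1}Λ`), given
  finitely many one-parameter families of Levi elements `q i z ∈ U` (`z ∈ 𝔭_v^j`) whose conjugations `L i z : t ↦ A t D⁻¹` are bi-continuous additive
  automorphisms of `S` fixing a reference set `Λ₀` of finite positive measure and the shell `Sh` (so they preserve `μ`, ★ F1 §3), a unitary weight `χ`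
  with the CHARACTER FACTORISATION `χ(L i z t) = χ(t)·ψ_v(z·c i t)` on `Sh` (for `χ = ψ̄_β ∘ n`: `c i t = −Tr tr(β(u_i t + t u_i′))`, the quadratic term
  `z² u_i t u_i′` being `ψ_β`-negligible on the shell — file F3), boxes `{c i ∈ 𝔭^{d−j}}` permuted by the moves, and the COVERING condition
  `∀ t ∈ Sh, ∃ i, c i t ∉ 𝔭^{d−j}` (= `det β ≠ 0` on a far shell, file F3): `∫_{Sh} φ·χ dμ = 0` (★ F1 `setIntegral_eq_zero_of_averaging`).
* §3 `setIntegral_eq_zero_of_unipotent_translate` — THE LATTICE-SUPPORT CLAUSE: if `n(t₀) ∈ U` and `χ(t + t₀) = ζ·χ(t)` with `ζ ≠ 1` (`ζ = ψ̄_β(t₀)`), then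
  `∫_B φ·χ dμ = 0` for every measurable `B` with `B + t₀ = B` (★ F1 `setIntegral_eq_zero_of_translate`; `φ(t + t₀) = φ(t)` by ★ `nElem_add` + right invariance):
  the local coefficient vanishes unless `ψ_β` is trivial on the invariance lattice of `f`, i.e. unless `β` lies in the dual lattice.
What is NOT here (next files): the supply of Levi elements of level `m` in `K_v` (F3, matrix algebra over `E ⊗ F_v`), the character factorisation and the
covering from `det β ≠ 0` (F3), and the three exported heads (ball formula for all `s`, `Differentiable ℂ`, the bound; F4b over ★ F2).

## References
* [Casselman1980] W. Casselman, *The unramified principal series of p-adic groups I*, Compositio Math. 40 (1980), §3.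
* [KudlaRallis1994] S. Kudla, S. Rallis, Ann. of Math. 140 (1994), §2 (local Whittaker functionals of degenerate principal series are entire).
* [Shimura1997] G. Shimura, *Euler products and Eisenstein series*, CBMS 93 (1997), §18 (local coefficients at bad places).
* [HarrisKudlaSweet1996] M. Harris, S. Kudla, W. J. Sweet, J. AMS 9 (1996): §1 (1.11)–(1.15) (`P_Δ = M_Δ N_Δ`, `M_Δ` acts on `N_Δ ≅ Herm_n` by `t ↦ A t D⁻¹`).
-/

set_option autoImplicit false
-- the mandated namespace repeats the single-problem summit's segment (`HodgeConjecture.HodgeConjecture`)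
set_option linter.dupNamespace false

noncomputable section

open scoped NNReal ENNReal
open NumberField IsDedekindDomain Matrix MeasureTheory Set
open Literature.NumberTheory.Automorphic Literature.NumberTheory.Automorphic.UnitaryGroup
open Literature.NumberTheory.GelbartRogawski1991.AdaptedBlocks
open Literature.NumberTheory.GelbartRogawski1991.UnitaryDualPair.LocalSplitting
open Literature.NumberTheory.K2Lit.LocalSiegelDoubled
open Summit.HodgeConjecture.HodgeConjecture.Cruxes.HLiu418.K2LiuSiegelLeviWeylAlgebra
open Summit.HodgeConjecture.HodgeConjecture.Cruxes.HLiu418.K2LiuUnipDeltaLocalCoordinates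
open Summit.HodgeConjecture.HodgeConjecture.Cruxes.HLiu418.K2LiuShellVanishingByAveraging

namespace Summit.HodgeConjecture.HodgeConjecture.Cruxes.HLiu418.K2LiuBadPlaceWhittakerShells

variable (F : Type) [Field F] [NumberField F] (E : Type) [Field E] [NumberField E] [Algebra F E]
  [Algebra.IsQuadraticExtension F E] (c : E ≃ₐ[F] E)
  {δ : E} (hcδ : c δ = -δ) (hδ : δ ≠ 0) {dd : F} (hd : δ * δ = algebraMap F E dd)
  (v : HeightOneSpectrum (𝓞 F)) (n : ℕ) {T₀ : Matrix (Fin n) (Fin n) F} (hT₀ : T₀.IsSymm)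
  {JD : Matrix (Fin (n + n)) (Fin (n + n)) E} (hJD : JD = (gramD F n T₀).map (algebraMap F E))

/-! ## §1 Levi invariance of the pulled-back section `t ↦ f(w_Δ n(t))` -/

omit [Algebra.IsQuadraticExtension F E] in
include hJD in
/-- **`n(A t D⁻¹) = q n(t) q⁻¹`** for `q ∈ P_Δ(F_v)` with adapted blocks `A = blkA`, `D = blkD` (★ `blkB_matA_conj_nElem`, ★ `eq_nElem_of_mem_unipDeltaLocal`).
[cite: HarrisKudlaSweet1996, §1 (1.12)] -/
theorem nElem_conj_eq {q : UnitaryGroup.localPi E c (n + n) JD v} (hC : blkC (matA F E c v n q) = 0)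
    {t : Matrix (Fin n) (Fin n) (LocalRing E v)} (ht : (t.map (conjLocal E c v))ᵀ * gramS F E v n T₀ + gramS F E v n T₀ * t = 0)
    (hAtD : ((blkA (matA F E c v n q) * t * (blkD (matA F E c v n q))⁻¹).map (conjLocal E c v))ᵀ * gramS F E v n T₀ +
      gramS F E v n T₀ * (blkA (matA F E c v n q) * t * (blkD (matA F E c v n q))⁻¹) = 0) :
    nElem F E c v n hJD (blkA (matA F E c v n q) * t * (blkD (matA F E c v n q))⁻¹) hAtD = q * nElem F E c v n hJD t ht * q⁻¹ := by
  have hu := conj_nElem_mem_unipDeltaLocal F E c v n hJD hC ht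
  have h1 := eq_nElem_of_mem_unipDeltaLocal F E c v n hJD hu
  have h2 := blkB_matA_conj_nElem F E c v n hJD hC ht
  rw [h1]
  exact nElem_congr F E c v n hJD h2.symm _ _

include hcδ hδ hd hT₀ hJD in
/-- **Levi invariance of the pulled-back section**: for a Siegel section `f ∈ I_v(s, χ_v)` right-invariant under `U`, and a Levi element `q ∈ U` (blocks
`diag(A, D)`) whose Weyl conjugate `w_Δ q w_Δ` has `χ_v(det_Δ) = 1` and `|det_Δ|_v = 1`:  `f(w_Δ n(A t D⁻¹)) = f(w_Δ n(t))`.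
[cite: Casselman1980, §3] [cite: HarrisKudlaSweet1996, §1 (1.12), (1.15)] -/
theorem apply_weylDelta_nElem_conj {χv : ∀ w : PlacesOver E v, (w.1.adicCompletion E)ˣ →* ℂˣ} {s : ℂ}
    {f : UnitaryGroup.localPi E c (n + n) JD v → ℂ} (hf : IsLocalSiegelSection F E c hcδ hδ hd v n hT₀ hJD χv s f)
    {U : Subgroup (UnitaryGroup.localPi E c (n + n) JD v)} (hfU : ∀ g k, k ∈ U → f (g * k) = f g)
    {q : UnitaryGroup.localPi E c (n + n) JD v} (hqU : q ∈ U) (hC : blkC (matA F E c v n q) = 0) (hB : blkB (matA F E c v n q) = 0)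
    (hχ : chiDet F E c v n χv (weylDelta F E c v n hJD * q * weylDelta F E c v n hJD) = 1)
    (habs : absDetDelta F E c v n (weylDelta F E c v n hJD * q * weylDelta F E c v n hJD) = 1)
    {t : Matrix (Fin n) (Fin n) (LocalRing E v)} (ht : (t.map (conjLocal E c v))ᵀ * gramS F E v n T₀ + gramS F E v n T₀ * t = 0)
    (hAtD : ((blkA (matA F E c v n q) * t * (blkD (matA F E c v n q))⁻¹).map (conjLocal E c v))ᵀ * gramS F E v n T₀ +
      gramS F E v n T₀ * (blkA (matA F E c v n q) * t * (blkD (matA F E c v n q))⁻¹) = 0) :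
    f (weylDelta F E c v n hJD * nElem F E c v n hJD (blkA (matA F E c v n q) * t * (blkD (matA F E c v n q))⁻¹) hAtD) =
      f (weylDelta F E c v n hJD * nElem F E c v n hJD t ht) := by
  rw [nElem_conj_eq F E c v n hJD hC ht hAtD]
  have hw : weylDelta F E c v n hJD (T₀ := T₀) * weylDelta F E c v n hJD = 1 := weylDelta_mul_self F E c v n hJD
  have e1 : weylDelta F E c v n hJD * (q * nElem F E c v n hJD t ht * q⁻¹) =
      (weylDelta F E c v n hJD * q * weylDelta F E c v n hJD) * ((weylDelta F E c v n hJD * nElem F E c v n hJD t ht) * q⁻¹) := by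
    calc weylDelta F E c v n hJD * (q * nElem F E c v n hJD t ht * q⁻¹)
        = weylDelta F E c v n hJD * q * (weylDelta F E c v n hJD * weylDelta F E c v n hJD) * nElem F E c v n hJD t ht * q⁻¹ := by
          rw [hw]; simp only [mul_one, mul_assoc]
      _ = (weylDelta F E c v n hJD * q * weylDelta F E c v n hJD) * ((weylDelta F E c v n hJD * nElem F E c v n hJD t ht) * q⁻¹) := by
          simp only [mul_assoc]
  have hchar : localSiegelCharacter F E c v n χv s (weylDelta F E c v n hJD * q * weylDelta F E c v n hJD) = 1 := by
    unfold localSiegelCharacter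
    rw [hχ, habs, Units.val_one, Complex.ofReal_one, Complex.one_cpow, mul_one]
  rw [e1, hf _ (isSiegelDelta_weylDelta_conj F E c hcδ hδ hd v n hT₀ hJD hC hB), hfU _ _ (U.inv_mem hqU), hchar, one_mul]

/-! ## §2 The far shells vanish (Levi averaging) -/

include hcδ hδ hd hT₀ hJD in
/-- **The far shells of the local Whittaker integral vanish.**  `S = Skew` (any additive-subgroup realisation, `hS`), `μ` an additive Haar measure on `S`,
`φ(t) = f(w_Δ n(t))` the pulled-back Siegel section (right-`U`-invariant `f`, measurable and bounded on the shell), `χ` a unitary weight; `Sh` the shell,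
`Λ₀` a reference set of finite positive measure; `q i z ∈ U` (`i ∈ 𝓤`, `z ∈ 𝔭_v^j`) Levi elements with `χ_v`∕modulus-trivial Weyl conjugates whose
conjugations `L i z = (t ↦ A t D⁻¹)` are bi-continuous automorphisms of `S` fixing `Λ₀` and `Sh`; `χ(L i z t) = χ(t)·ψ_v(z·c i t)` on `Sh`, boxes permuted, and
every point of `Sh` has a coefficient `c i t ∉ 𝔭_v^{d−j}`.  Then `∫_{Sh} φ·χ dμ = 0`. [cite: Casselman1980, §3] [cite: KudlaRallis1994, §2] [cite: Shimura1997, §18] -/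
theorem setIntegral_shell_eq_zero_of_levi
    (S : AddSubgroup (Matrix (Fin n) (Fin n) (LocalRing E v)))
    (hS : ∀ t, t ∈ S ↔ (t.map (conjLocal E c v))ᵀ * gramS F E v n T₀ + gramS F E v n T₀ * t = 0)
    [MeasurableSpace S] [BorelSpace S] [LocallyCompactSpace S] (μ : Measure S) [μ.IsAddHaarMeasure] [μ.Regular]
    -- the section and its smoothness group
    {χv : ∀ w : PlacesOver E v, (w.1.adicCompletion E)ˣ →* ℂˣ} {s : ℂ} {f : UnitaryGroup.localPi E c (n + n) JD v → ℂ}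
    (hf : IsLocalSiegelSection F E c hcδ hδ hd v n hT₀ hJD χv s f)
    {U : Subgroup (UnitaryGroup.localPi E c (n + n) JD v)} (hfU : ∀ g k, k ∈ U → f (g * k) = f g)
    (hφm : Measurable fun t : S => f (weylDelta F E c v n hJD * nElem F E c v n hJD t.1 ((hS t.1).1 t.2)))
    -- the unitary weight
    {χ : S → ℂ} (hχm : Measurable χ) (hχ1 : ∀ t, ‖χ t‖ ≤ 1)
    -- `F_v`, the additive character, the averaging ball `𝔭_v^j`
    [MeasurableSpace (v.adicCompletion F)] [BorelSpace (v.adicCompletion F)]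
    (μF : Measure (v.adicCompletion F)) [μF.IsAddHaarMeasure] {ψ : AddChar (v.adicCompletion F) Circle} (hψ : Continuous ψ)
    {dψ : ℤ} (hdψ : ψ.HasConductorExp dψ) (j : ℤ)
    -- the shell and the reference lattice
    {Sh Λ₀ : Set S} (hShm : MeasurableSet Sh) (hShμ : μ Sh ≠ ∞) (hΛ₀0 : μ Λ₀ ≠ 0) (hΛ₀ : μ Λ₀ ≠ ∞)
    {C : ℝ} (hφC : ∀ t ∈ Sh, ‖f (weylDelta F E c v n hJD * nElem F E c v n hJD t.1 ((hS t.1).1 t.2))‖ ≤ C)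
    -- the Levi moves
    {ι : Type*} (𝓤 : Finset ι) (q : ι → v.adicCompletion F → UnitaryGroup.localPi E c (n + n) JD v)
    (L : ι → v.adicCompletion F → (S ≃ₜ+ S)) (cc : ι → S → v.adicCompletion F) (hcm : ∀ i ∈ 𝓤, Measurable (cc i))
    (hqU : ∀ i ∈ 𝓤, ∀ z ∈ primePowBall (v.adicCompletion F) j, q i z ∈ U)
    (hqC : ∀ i ∈ 𝓤, ∀ z ∈ primePowBall (v.adicCompletion F) j, blkC (matA F E c v n (q i z)) = 0)
    (hqB : ∀ i ∈ 𝓤, ∀ z ∈ primePowBall (v.adicCompletion F) j, blkB (matA F E c v n (q i z)) = 0)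
    (hqχ : ∀ i ∈ 𝓤, ∀ z ∈ primePowBall (v.adicCompletion F) j,
      chiDet F E c v n χv (weylDelta F E c v n hJD * q i z * weylDelta F E c v n hJD) = 1)
    (hqabs : ∀ i ∈ 𝓤, ∀ z ∈ primePowBall (v.adicCompletion F) j,
      absDetDelta F E c v n (weylDelta F E c v n hJD * q i z * weylDelta F E c v n hJD) = 1)
    (hL : ∀ i ∈ 𝓤, ∀ z ∈ primePowBall (v.adicCompletion F) j, ∀ t : S,
      (L i z t).1 = blkA (matA F E c v n (q i z)) * t.1 * (blkD (matA F E c v n (q i z)))⁻¹)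
    (hLΛ₀ : ∀ i ∈ 𝓤, ∀ z ∈ primePowBall (v.adicCompletion F) j, (L i z) ⁻¹' Λ₀ = Λ₀)
    (hLSh : ∀ i ∈ 𝓤, ∀ z ∈ primePowBall (v.adicCompletion F) j, (L i z) ⁻¹' Sh = Sh)
    -- the character factorisation, the boxes, the covering
    (hχL : ∀ i ∈ 𝓤, ∀ z ∈ primePowBall (v.adicCompletion F) j, ∀ t ∈ Sh, χ (L i z t) = χ t * ((ψ (z * cc i t) : Circle) : ℂ))
    (hbox : ∀ i ∈ 𝓤, ∀ i' ∈ 𝓤, ∀ z ∈ primePowBall (v.adicCompletion F) j, ∀ t ∈ Sh,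
      (cc i (L i' z t) ∈ primePowBall (v.adicCompletion F) (dψ - j) ↔ cc i t ∈ primePowBall (v.adicCompletion F) (dψ - j)))
    (hcov : ∀ t ∈ Sh, ∃ i ∈ 𝓤, cc i t ∉ primePowBall (v.adicCompletion F) (dψ - j)) :
    ∫ t in Sh, f (weylDelta F E c v n hJD * nElem F E c v n hJD t.1 ((hS t.1).1 t.2)) * χ t ∂μ = 0 := by
  -- pointwise Levi invariance of `φ` under the moves
  have hφL : ∀ i ∈ 𝓤, ∀ z ∈ primePowBall (v.adicCompletion F) j, ∀ t : S,
      f (weylDelta F E c v n hJD * nElem F E c v n hJD (L i z t).1 ((hS (L i z t).1).1 (L i z t).2)) =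
        f (weylDelta F E c v n hJD * nElem F E c v n hJD t.1 ((hS t.1).1 t.2)) := by
    intro i hi z hz t
    have hAtD : ((blkA (matA F E c v n (q i z)) * t.1 * (blkD (matA F E c v n (q i z)))⁻¹).map (conjLocal E c v))ᵀ * gramS F E v n T₀ +
        gramS F E v n T₀ * (blkA (matA F E c v n (q i z)) * t.1 * (blkD (matA F E c v n (q i z)))⁻¹) = 0 := by
      rw [← hL i hi z hz t]
      exact (hS _).1 (L i z t).2
    rw [nElem_congr F E c v n hJD (hL i hi z hz t) _ hAtD]
    exact apply_weylDelta_nElem_conj F E c hcδ hδ hd v n hT₀ hJD hf hfU (hqU i hi z hz) (hqC i hi z hz) (hqB i hi z hz) (hqχ i hi z hz)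
      (hqabs i hi z hz) ((hS t.1).1 t.2) hAtD
  -- apply the abstract averaging theorem (★ F1)
  refine setIntegral_eq_zero_of_averaging 𝓤 μF hψ hdψ j μ hShm hShμ (hφm.mul hχm) (C := C) ?_ (L := fun i z => ⇑(L i z)) hcm ?_ ?_ hbox hcov
  · intro t ht
    rw [norm_mul]
    have hC0 : 0 ≤ C := (norm_nonneg _).trans (hφC t ht)
    calc ‖f (weylDelta F E c v n hJD * nElem F E c v n hJD t.1 ((hS t.1).1 t.2))‖ * ‖χ t‖ ≤ C * 1 :=
          mul_le_mul (hφC t ht) (hχ1 t) (norm_nonneg _) hC0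
      _ = C := mul_one C
  · intro i hi z hz g'
    exact setIntegral_comp_eq_of_preimage_eq μ (L i z) hΛ₀0 hΛ₀ (hLΛ₀ i hi z hz) (hLSh i hi z hz) g'
  · intro i hi z hz t ht
    rw [hφL i hi z hz t, hχL i hi z hz t ht, mul_assoc]

/-! ## §3 The lattice-support clause -/

omit [Algebra.IsQuadraticExtension F E] in
include hJD in
/-- **Vanishing off the dual lattice**: if `n(t₀) ∈ U` (the smoothness group of `f`) and `χ(t + t₀) = ζ·χ(t)` with `ζ ≠ 1` (`χ = ψ̄_β ∘ n`, `ζ = ψ̄_β(t₀)`),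
then `∫_B f(w_Δ n(t))·χ(t) dμ(t) = 0` for every measurable `B ⊆ S` stable under `t ↦ t + t₀` (every ball `ϖ^{−k}Λ ⊇ ϖ^mΛ ∋ t₀`): the local Whittaker coefficient
of `f` is supported on the `β` for which `ψ_β` is trivial on the invariance lattice of `f`. [cite: Casselman1980, §3] [cite: Shimura1997, §18] -/
theorem setIntegral_eq_zero_of_unipotent_translate
    (S : AddSubgroup (Matrix (Fin n) (Fin n) (LocalRing E v)))
    (hS : ∀ t, t ∈ S ↔ (t.map (conjLocal E c v))ᵀ * gramS F E v n T₀ + gramS F E v n T₀ * t = 0)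
    [MeasurableSpace S] [BorelSpace S] (μ : Measure S) [μ.IsAddRightInvariant]
    {f : UnitaryGroup.localPi E c (n + n) JD v → ℂ} {U : Subgroup (UnitaryGroup.localPi E c (n + n) JD v)} (hfU : ∀ g k, k ∈ U → f (g * k) = f g)
    {t₀ : S} (ht₀U : nElem F E c v n hJD t₀.1 ((hS t₀.1).1 t₀.2) ∈ U)
    {χ : S → ℂ} {ζ : ℂ} (hχ : ∀ t, χ (t + t₀) = ζ * χ t) (hζ : ζ ≠ 1)
    {B : Set S} (hBm : MeasurableSet B) (hBt : ∀ t, t + t₀ ∈ B ↔ t ∈ B) :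
    ∫ t in B, f (weylDelta F E c v n hJD * nElem F E c v n hJD t.1 ((hS t.1).1 t.2)) * χ t ∂μ = 0 := by
  refine setIntegral_eq_zero_of_translate μ hBm hBt (fun t _ => ?_) hζ
  have hn : nElem F E c v n hJD (t + t₀).1 ((hS (t + t₀).1).1 (t + t₀).2) =
      nElem F E c v n hJD t.1 ((hS t.1).1 t.2) * nElem F E c v n hJD t₀.1 ((hS t₀.1).1 t₀.2) := by
    rw [← nElem_add F E c v n hJD]
    exact nElem_congr F E c v n hJD rfl _ _
  rw [hn, ← mul_assoc, hfU _ _ ht₀U, hχ t]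
  ring

end Summit.HodgeConjecture.HodgeConjecture.Cruxes.HLiu418.K2LiuBadPlaceWhittakerShells

end
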